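import Summits.ResolutionOfSingularities.ResolutionOfSingularities.Theorems.PurelyInseparableDim4ChartAtlasSNCObstruction
import Summits.ResolutionOfSingularities.ResolutionOfSingularities.Theorems.PurelyInseparableDim4CoordinateSNCTranslated
import HarnessLib

/-!
# Purely inseparable four-folds `z^p + F(x₁, …, x₄)`: ONE sheared old boundary member is harmless — the positive half of the
# chart-level SNC criterion for escaping global centres (brick S3-N2; cell `res-dim4-pi`, typ-2 g5)

[OURS · counted 0] (D-0157 DOOR 2; DR-157-C; desk WORD #115 (a) (S3-N2), WORD #131 (c); frame `PIDim4.TerminationImpliesOrderReduction`,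
S3 (c)). Companion of `…ChartAtlasSNCObstruction` (negative: TWO «bad» members — `x_j·𝒪` together with a sheared
`(x_m + b x_j)·𝒪`, or two sheared ones — break simple normal crossings with the centre `V(z, x_T)` read on the chart `x_l`).
PROVED here (no `sorry`, no new axiom): with at most ONE sheared member the crossing is still simple normal:

* `exists_algEquiv_unshear` — the `K`-automorphism `Ξ` of `K[z, x]` with `Ξ x_j = x_m + b·x_j`, all other variables fixed;
* `comap_unshear_𝓘Λ`, `comap_unshear_hyperplane_of_ne`, `comap_unshear_hyperplane_self` — `Spec Ξ` fixes the centre `𝓘Λ_T`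
  (`j ∉ T`) and every translated hyperplane `(xᵢ + cᵢ)·𝒪`, `i ≠ j`, and carries `x_j·𝒪` to `(x_m + b x_j)·𝒪`;
* **`hasSNCWith_shear_translatedHyperplanes_𝓘Λ`** — on `𝔸⁵_K`: for `m ∈ T`, `j ∉ T`, any `b`, any list `l` of coordinates
  NOT containing `j` and constants `c` vanishing on `{z} ∪ T`: the boundary `(x_m + b x_j)·𝒪 :: [(xᵢ + cᵢ)·𝒪 : i ∈ l]` HAS simple
  normal crossings with `𝓘Λ_T` (transport of typ-2 g2's `hasSNCWith_translatedHyperplanes_𝓘Λ` along `Spec Ξ`).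

CHART-LEVEL S3-N2 DICHOTOMY (with the obstruction file): the boundary read on the chart `x_l` consists of `E₁ = x_l·𝒪`, translated
hyperplanes `(x_k + c_k)·𝒪` (`k ∉ S`), old members `x_i·𝒪` (`i ∈ S`, not translated away) and the «bad» members
`{x_j·𝒪} ∪ {(x_m + b_m x_j)·𝒪 : m ∈ T, b_m ≠ 0}` (old members `{x_j = 0}` / `{x_m = 0}` translated away at `b`); the escaping
global centre `V(z, x_T)` is snc with them iff AT MOST ONE bad member is present. HONEST SCOPE: chart model only (the
`W`-level positive needs the cover + typ-3's assembly); nothing about resolution of singularities in dimension ≥ 4 /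
characteristic `p` (NOT proved anywhere in this programme). bears_on: LADDER-RESOLUTION:D157-DOOR2 (res-dim4-pi). Supports
stmt-ResolutionOfSingularities-16155 (helper, S3-N2 positive).
-/

-- every declaration of this summit lives under `Summit.ResolutionOfSingularities.ResolutionOfSingularities`
-- (summit = problem), which the duplicate-namespace linter flags; house convention (cf. the Target file).
set_option linter.dupNamespace false

noncomputable section

open MvPolynomial Finset CategoryTheory AlgebraicGeometry Opposite TopologicalSpace
open AlgebraicGeometry.Scheme.IdealSheafData (ofIdealTop vanishingIdeal)

namespace Summit.ResolutionOfSingularities.ResolutionOfSingularities.Theorems.PIDim4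

open Literature.AlgebraicGeometry.Resolution
open Literature.AlgebraicGeometry.Resolution.AffinePointBlowup (P A γ coord Wtop ξ)

namespace ChartDictionary

variable {K : Type} [Field K] {T : Finset (Fin 4)} {j m : Fin 4} {b : K}

/-! ## §1 The un-shearing automorphism `Ξ`: `x_j ↦ x_m + b·x_j` -/

/-- **The automorphism `Ξ` of `K[z, x]`**: `Ξ x_j = x_m + b·x_j`, every other variable fixed (`m ≠ j`, `b ≠ 0`; inverse
`x_j ↦ b⁻¹ (x_j − x_m)`). -/
theorem exists_algEquiv_unshear (hmj : m ≠ j) (hb : b ≠ 0) :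
    ∃ Ξ : A 4 K ≃ₐ[K] A 4 K, Ξ (X j.succ) = X m.succ + C b * X j.succ ∧ ∀ i : Fin (4 + 1), i ≠ j.succ → Ξ (X i) = X i := by
  classical
  have hmj' : m.succ ≠ j.succ := fun e => hmj (Fin.succ_inj.mp e)
  let f : Fin (4 + 1) → A 4 K := fun i => if i = j.succ then X m.succ + C b * X j.succ else X i
  let g : Fin (4 + 1) → A 4 K := fun i => if i = j.succ then C b⁻¹ * (X j.succ - X m.succ) else X i
  have hfm : aeval f (X m.succ : A 4 K) = X m.succ := by rw [aeval_X]; exact if_neg hmj'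
  have hgm : aeval g (X m.succ : A 4 K) = X m.succ := by rw [aeval_X]; exact if_neg hmj'
  have hfj : aeval f (X j.succ : A 4 K) = X m.succ + C b * X j.succ := by rw [aeval_X]; exact if_pos rfl
  have hgj : aeval g (X j.succ : A 4 K) = C b⁻¹ * (X j.succ - X m.succ) := by rw [aeval_X]; exact if_pos rfl
  refine ⟨AlgEquiv.ofAlgHom (aeval f) (aeval g) ?_ ?_, ?_, fun i hi => ?_⟩
  · refine MvPolynomial.algHom_ext fun i => ?_
    rw [AlgHom.comp_apply, AlgHom.id_apply, aeval_X]
    by_cases hi : i = j.succ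
    · subst hi
      rw [show g j.succ = C b⁻¹ * (X j.succ - X m.succ) from if_pos rfl, map_mul, map_sub, aeval_C, hfj, hfm, algebraMap_eq]
      rw [add_sub_cancel_left, ← mul_assoc, ← C_mul, inv_mul_cancel₀ hb, C_1, one_mul]
    · rw [show g i = X i from if_neg hi, aeval_X]
      exact if_neg hi
  · refine MvPolynomial.algHom_ext fun i => ?_
    rw [AlgHom.comp_apply, AlgHom.id_apply, aeval_X]
    by_cases hi : i = j.succ
    · subst hi
      rw [show f j.succ = X m.succ + C b * X j.succ from if_pos rfl, map_add, map_mul, aeval_C, hgj, hgm, algebraMap_eq,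
        ← mul_assoc, ← C_mul, mul_inv_cancel₀ hb, C_1, one_mul, add_sub_cancel]
    · rw [show f i = X i from if_neg hi, aeval_X]
      exact if_neg hi
  · change aeval f (X j.succ) = _
    exact hfj
  · change aeval f (X i) = X i
    rw [aeval_X]
    exact if_neg hi

/-! ## §2 `Spec Ξ` on the centre and on the hyperplane sheaves -/

/-- `Spec Ξ` fixes the coordinate centre `𝓘Λ_Λ` when `Ξ` fixes the variables of `Λ`. -/
theorem comap_unshear_𝓘Λ {Ξ : A 4 K ≃ₐ[K] A 4 K} {Λ : Set (Fin (4 + 1))} (hΞ : ∀ i ∈ Λ, Ξ (X i) = X i) :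
    (AffineCoordBlowup.𝓘Λ 4 K Λ).comap (Spec.map (CommRingCat.ofHom (Ξ : A 4 K →+* A 4 K))) = AffineCoordBlowup.𝓘Λ 4 K Λ := by
  rw [𝓘Λ_eq_ofIdealTop, comap_ofIdealTop_of_isAffine, Ideal.map_span, ← Set.image_comp]
  congr 2
  refine Set.image_congr fun i hi => ?_
  rw [Function.comp_apply, show coord 4 K i = (γ 4 K).symm (X i) from rfl, appTop_specMap_γ_symm, RingHom.coe_coe, hΞ i hi]

/-- `Spec Ξ` fixes the translated hyperplane sheaf `(xᵢ + c)·𝒪` when `Ξ xᵢ = xᵢ`. -/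
theorem comap_unshear_hyperplane_of_fix {Ξ : A 4 K ≃ₐ[K] A 4 K} {i : Fin (4 + 1)} (hΞ : Ξ (X i) = X i) (c : K) :
    (ofIdealTop (Ideal.span {(γ 4 K).symm (X i + C c)})).comap (Spec.map (CommRingCat.ofHom (Ξ : A 4 K →+* A 4 K))) =
      ofIdealTop (Ideal.span {(γ 4 K).symm (X i + C c)}) := by
  have hC : Ξ (C c) = C c := Ξ.commutes c
  rw [comap_ofIdealTop_span_γ_symm, RingHom.coe_coe, map_add, hΞ, hC]

/-- `Spec Ξ` carries `x_j·𝒪` to `(x_m + b·x_j)·𝒪` when `Ξ x_j = x_m + b x_j`. -/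
theorem comap_unshear_hyperplane_self {Ξ : A 4 K ≃ₐ[K] A 4 K} (hΞ : Ξ (X j.succ) = X m.succ + C b * X j.succ) :
    (ofIdealTop (Ideal.span {(γ 4 K).symm (X j.succ + C 0)})).comap (Spec.map (CommRingCat.ofHom (Ξ : A 4 K →+* A 4 K))) =
      ofIdealTop (Ideal.span {(γ 4 K).symm (X m.succ + C b * X j.succ)}) := by
  rw [comap_ofIdealTop_span_γ_symm, RingHom.coe_coe, C_0, add_zero, hΞ]

/-! ## §3 One sheared member: simple normal crossings hold -/

/-- **ONE SHEARED OLD MEMBER IS HARMLESS.** On `𝔸⁵_K`, for `m ∈ T`, `j ∉ T`, `b ≠ 0`, a list `l` of coordinates with `j ∉ l`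
and constants `c` with `cᵢ = 0` on `{z} ∪ T`: the boundary `(x_m + b·x_j)·𝒪 :: [(xᵢ + cᵢ)·𝒪 : i ∈ l]` has simple normal
crossings with the coordinate centre `𝓘Λ_T = 𝓘(V(z, x_T))`. -/
theorem hasSNCWith_shear_translatedHyperplanes_𝓘Λ (hmT : m ∈ T) (hjT : j ∉ T) (hb : b ≠ 0) (l : List (Fin (4 + 1)))
    (hjl : j.succ ∉ l) (c : Fin (4 + 1) → K) (hc : ∀ i ∈ insert (0 : Fin (4 + 1)) (Fin.succ '' (T : Set (Fin 4))), c i = 0) :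
    HasSNCWith (ofIdealTop (Ideal.span {(γ 4 K).symm (X m.succ + C b * X j.succ)}) ::
        l.map fun i => ofIdealTop (Ideal.span {(γ 4 K).symm (X i + C (c i))}))
      (AffineCoordBlowup.𝓘Λ 4 K (insert 0 (Fin.succ '' (T : Set (Fin 4))))) := by
  classical
  have hmj : m ≠ j := fun e => hjT (e ▸ hmT)
  obtain ⟨Ξ, hΞj, hΞ⟩ := exists_algEquiv_unshear (K := K) hmj hb
  haveI : IsIso (CommRingCat.ofHom (Ξ : A 4 K →+* A 4 K)) :=
    (inferInstance : IsIso Ξ.toRingEquiv.toCommRingCatIso.hom)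
  -- the coordinate configuration `x_j :: l` with constants `c' = c[j ↦ 0]`
  set c' : Fin (4 + 1) → K := Function.update c j.succ 0 with hc'
  have hc'T : ∀ i ∈ insert (0 : Fin (4 + 1)) (Fin.succ '' (T : Set (Fin 4))), c' i = 0 := by
    intro i hi
    by_cases hij : i = j.succ
    · rw [hij, hc', Function.update_self]
    · rw [hc', Function.update_of_ne hij]; exact hc i hi
  have hjΛ : j.succ ∉ insert (0 : Fin (4 + 1)) (Fin.succ '' (T : Set (Fin 4))) := fun h =>
    hjT ((succ_mem_centreVars_iff T j).mp h)
  have h0 := hasSNCWith_translatedHyperplanes_𝓘Λ (K := K) (j.succ :: l) c' (insert 0 (Fin.succ '' (T : Set (Fin 4)))) hc'T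
  have h1 := h0.comap_of_isOpenImmersion (Spec.map (CommRingCat.ofHom (Ξ : A 4 K →+* A 4 K)))
  rw [comap_unshear_𝓘Λ (fun i hi => hΞ i (fun e => hjΛ (e ▸ hi)))] at h1
  simp only [List.map_cons, List.map_map] at h1
  convert h1 using 2
  · rw [hc', Function.update_self, comap_unshear_hyperplane_self hΞj]
  · refine List.map_congr_left fun i hi => ?_
    have hij : i ≠ j.succ := fun e => hjl (e ▸ hi)
    rw [Function.comp_apply, comap_unshear_hyperplane_of_fix (hΞ i hij), hc', Function.update_of_ne hij]

end ChartDictionary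

end Summit.ResolutionOfSingularities.ResolutionOfSingularities.Theorems.PIDim4

end
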